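import Literature.NumberTheory.Automorphic.TateLocalFactors
import Literature.NumberTheory.Automorphic.AddCharConductorExponent
import Literature.NumberTheory.Automorphic.RankinSelbergLocalGammaCounterexample
import HarnessLib

/-!
# The named facts of `TateLocalFactors` on the trivial σ-algebra: `existsUnique_hasTateGamma`,
# `existsUnique_hasTateEpsilon`, `hasTateEpsilon_ne_zero`, `hasTateEpsilon_exponent` are false
# as elaborated

`Literature/NumberTheory/Automorphic/TateLocalFactors.lean` states Tate's local functional
equation (Tate 1950, Thm. 2.4.1; Bushnell–Henniart 2006, §23.4–23.5) through the predicate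
`HasTateGamma ψ μ μ' χ γ` and records `∃! γ` (`existsUnique_hasTateGamma`), `∃! (e, a)`
(`existsUnique_hasTateEpsilon`), `e ≠ 0` (`hasTateEpsilon_ne_zero`) and `a = a(χ) - n(ψ)`
(`hasTateEpsilon_exponent`) as named facts. They sit in a section
`variable [MeasurableSpace F] … [BorelSpace F]` ("measurable structures are instance arguments",
design note H7), but a `def … : Prop` abstracts only the section variables its body uses: the four
facts kept `[MeasurableSpace F]` and LOST `[BorelSpace F]` (`#check @existsUnique_hasTateGamma` reads
`… [MeasurableSpace F] → AddChar F Circle → Measure F → Measure Fˣ → QuasiChar F → Prop`), while their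
Haar hypotheses `[μ.IsAddHaarMeasure] [μ'.IsHaarMeasure]` are binders inside the `∀` and refer to
WHATEVER σ-algebra `F` carries (and `Fˣ` carries its pull-back `Units.instMeasurableSpace`). This is
the binder loss diagnosed for the Rankin–Selberg facts in `RankinSelbergLocalGammaCounterexample`
(there the invariance of `ν` was lost); here it is the Borel hypothesis, and the facts are again
false as elaborated:

* On the TRIVIAL σ-algebra `⊥ = {∅, univ}` of a non-archimedean local field `F`, the Dirac mass
  `δ₀` is an additive Haar measure in Mathlib's sense (`isAddHaarMeasure_dirac_of_trivial`: it is
  finite; every non-empty set has outer measure `δ₀(univ) = 1`, so it is positive on non-empty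
  opens; and `δ_g = δ₀` as measures on `{∅, univ}`, so it is translation invariant), and likewise
  `δ₁` is a Haar measure on `Fˣ` (`isHaarMeasure_dirac_of_trivial`; the pulled-back σ-algebra is
  again trivial, `trivial_units`).
* Against a measure on the trivial σ-algebra the Bochner integral of every NON-CONSTANT function
  vanishes (`integral_eq_zero_of_trivial`: an a.e.-strongly-measurable function is a.e. equal to a
  constant, and the only null set is `∅`). A Schwartz–Bruhat `f ≠ 0` has a zero (its support is
  compact and `F` is not, `not_compactSpace_of_isNonarchimedeanLocalField`,
  `exists_ne_zero_and_eq_zero_of_mem_schwartzBruhat`), so the integrands `ψ(xy) f(x)` and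
  `f(x) χ(x) |x|^s` are non-constant or zero: `fourierSB ψ μ f = 0` and `tateZeta μ' f χ s = 0` for
  every Schwartz–Bruhat `f` (`fourierSB_eq_zero_of_trivial`, `tateZeta_eq_zero_of_trivial`).
* Hence `HasTateGamma ψ μ μ' χ γ` holds for EVERY `γ` (`hasTateGamma_of_trivial`: both sides of the
  functional equation are `0`), `HasTateEpsilon ψ μ μ' χ e a` for every `(e, a)`
  (`hasTateEpsilon_of_trivial`), and: `¬ existsUnique_hasTateGamma` (`0` and `1` qualify),
  `¬ existsUnique_hasTateEpsilon` (`(0,0)` and `(1,0)`), `¬ hasTateEpsilon_ne_zero` (`e = 0`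
  qualifies), `¬ hasTateEpsilon_exponent` for `χ = 1` (`a = 1 - n(ψ)` qualifies as well as
  `a = -n(ψ)`; `ψ` has a conductor exponent, `AddChar.IsContinuousNontrivial.exists_hasConductorExp`,
  and `χ = 1` has conductor exponent `0`) — for every continuous non-trivial `ψ`
  (`not_existsUnique_hasTateGamma_of_trivial`, `…_hasTateEpsilon_of_trivial`,
  `not_hasTateEpsilon_ne_zero_of_trivial`, `not_hasTateEpsilon_exponent_of_trivial`).
* CLOSED counterexamples to the universally quantified facts (`not_forall_existsUnique_hasTateGamma`,
  `not_forall_existsUnique_hasTateEpsilon`, `not_forall_hasTateEpsilon_ne_zero`,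
  `not_forall_hasTateEpsilon_exponent`): `F = ℚ_v` at a finite place `v` of `ℚ` where the local
  component `ψ_v` of Tate's adelic character is non-trivial (all but finitely many `v`,
  `eventually_exists_adeleAddCharAt_ne_one`, as in `RankinSelbergLocalGammaCounterexample`), its
  trivial σ-algebra, `μ = δ₀`, `μ' = δ₁`, `χ = 1`.

So no closed proofs `existsUnique_hasTateGamma_holds`, `existsUnique_hasTateEpsilon_holds`,
`hasTateEpsilon_ne_zero_holds`, `hasTateEpsilon_exponent_holds` can exist. The intended — and, by
Tate's thesis, true — statements carry `[BorelSpace F]` (with the Haar hypotheses) as binders: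
e.g. `∀ [BorelSpace F] (hψ : ψ.IsContinuousNontrivial) [μ.IsAddHaarMeasure] [μ'.IsHaarMeasure],
∃! γ, HasTateGamma ψ μ μ' χ γ`; the proved uniqueness half `HasTateGamma.unique`
(`TateLocalFactorsProofs`) indeed assumes `[BorelSpace F]`. The fifth fact `hasTateEpsilon_unramified`
is not refuted this way (at the trivial σ-algebra its conclusion holds), nor is the Rankin–Selberg
fact `hasRSGamma_tate_compatible` (its hypothesis `IsSelfDualMeasure ψ μ` fails at the trivial
σ-algebra, since `fourierSB ψ μ (fourierSB ψ μ f) = 0 ≠ f(-·)`; see `RankinSelbergLocalTateCorrected`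
for its corrected statement). Theorems only; no definitions, no named facts (D-0026).

## References

* J. Tate, *Fourier analysis in number fields and Hecke's zeta-functions* (thesis, 1950), in
  Cassels–Fröhlich, *Algebraic Number Theory* (1967), §2.2 (`dx`, `d×x` Haar), Thm. 2.4.1, §2.5.
  [Tate1950]
* C. J. Bushnell, G. Henniart, *The local Langlands conjecture for `GL(2)`*, Springer 2006,
  §23.4–23.5. [BushnellHenniart2006]
* Mathlib: `MeasurableSpace.measurableSet_bot_iff`, `MeasureTheory.exists_measurable_superset`,
  `MeasureTheory.integral_non_aestronglyMeasurable`, `MeasureTheory.Measure.map_dirac'`,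
  `MulArchimedean` (`ValuativeRel.IsRankLeOne`).
-/

set_option autoImplicit false

open MeasureTheory Set NumberField IsDedekindDomain ValuativeRel
open scoped NNReal

noncomputable section

namespace Literature.NumberTheory.Automorphic

/-! ### Measures and integrals on the trivial σ-algebra -/

section TrivialSigma

variable {α : Type*} [MeasurableSpace α]

/-- On the trivial σ-algebra (only `∅` and `univ` measurable) every non-empty set has outer
measure `μ(univ)`: its only measurable superset is `univ` (`exists_measurable_superset`). [folklore] -/
theorem measure_eq_measure_univ_of_trivial
    (hα : ∀ s : Set α, MeasurableSet s → s = ∅ ∨ s = univ) (μ : Measure α) {s : Set α}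
    (hs : s.Nonempty) : μ s = μ univ := by
  obtain ⟨t, hst, ht, hμ⟩ := exists_measurable_superset μ s
  rcases hα t ht with rfl | rfl
  · exact absurd (subset_empty_iff.1 hst) hs.ne_empty
  · exact hμ.symm

omit [MeasurableSpace α] in
/-- Every map into a space with the trivial σ-algebra is measurable. [folklore] -/
theorem measurable_of_trivial {β : Type*} [MeasurableSpace α] [MeasurableSpace β]
    (hβ : ∀ s : Set β, MeasurableSet s → s = ∅ ∨ s = univ) (f : α → β) : Measurable f := by
  intro s hs
  rcases hβ s hs with rfl | rfl
  · exact MeasurableSet.empty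
  · exact MeasurableSet.univ

/-- **Against a measure on the trivial σ-algebra, the Bochner integral of a non-constant function
is `0`.** An a.e.-strongly-measurable `f` is a.e. equal to a strongly measurable `g`; the level
set `{g = g(x)}` is measurable, hence `univ`, so `g` is constant; the exceptional set `{f ≠ g}` is
then non-empty (as `f` is not constant) and null, but on the trivial σ-algebra a non-empty set has
outer measure `μ(univ) ≠ 0` (`measure_eq_measure_univ_of_trivial`) unless `μ = 0`. So `f` is not
a.e.-strongly measurable and its integral is the junk value `0`
(`integral_non_aestronglyMeasurable`). [folklore] -/
theorem integral_eq_zero_of_trivial {E : Type*} [NormedAddCommGroup E] [NormedSpace ℝ E]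
    (hα : ∀ s : Set α, MeasurableSet s → s = ∅ ∨ s = univ) (μ : Measure α) {f : α → E}
    {x y : α} (hxy : f x ≠ f y) : ∫ a, f a ∂μ = 0 := by
  by_cases hμ : μ = 0
  · subst hμ
    exact integral_zero_measure f
  refine integral_non_aestronglyMeasurable fun hf => ?_
  obtain ⟨g, hg, hfg⟩ := hf
  have hconst : ∀ a, g a = g x := fun a => by
    have hS : MeasurableSet {b | g b = g x} := hg.measurableSet_eq_fun stronglyMeasurable_const
    rcases hα _ hS with h | h
    · have hx : x ∈ ({b | g b = g x} : Set α) := rfl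
      rw [h] at hx
      exact absurd hx (notMem_empty x)
    · have ha : a ∈ ({b | g b = g x} : Set α) := by rw [h]; exact mem_univ a
      exact ha
  have hN : ({a | f a ≠ g a} : Set α).Nonempty := by
    by_contra hN
    rw [not_nonempty_iff_eq_empty] at hN
    have h1 : ∀ a, f a = g a := fun a => by
      by_contra h
      have ha : a ∈ ({a | f a ≠ g a} : Set α) := h
      rw [hN] at ha
      exact ha
    exact hxy (by rw [h1 x, h1 y, hconst y])
  have h0 : μ {a | f a ≠ g a} = 0 := by
    have h := hfg
    rw [Filter.EventuallyEq, ae_iff] at h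
    exact h
  rw [measure_eq_measure_univ_of_trivial hα μ hN, Measure.measure_univ_eq_zero] at h0
  exact hμ h0

/-- The σ-algebra `Units.instMeasurableSpace` (pull-back along `Units.val`) of the units of a
monoid with the trivial σ-algebra is trivial. [folklore] -/
theorem trivial_units {M : Type*} [Monoid M] [MeasurableSpace M]
    (hM : ∀ s : Set M, MeasurableSet s → s = ∅ ∨ s = univ) :
    ∀ s : Set Mˣ, MeasurableSet s → s = ∅ ∨ s = univ := by
  intro s hs
  obtain ⟨t, ht, rfl⟩ := MeasurableSpace.measurableSet_comap.1 hs
  rcases hM t ht with rfl | rfl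
  · exact Or.inl rfl
  · exact Or.inr rfl

/-- **On the trivial σ-algebra of a topological group, the Dirac mass `δ₁` is a Haar measure in
Mathlib's sense**: finite (hence finite on compacts); every non-empty open set has outer measure
`δ₁(univ) = 1 ≠ 0`; and `map (g * ·) δ₁ = δ_g = δ₁` as measures on `{∅, univ}`. [folklore] -/
theorem isHaarMeasure_dirac_of_trivial {G : Type*} [Group G] [TopologicalSpace G]
    [MeasurableSpace G] (hG : ∀ s : Set G, MeasurableSet s → s = ∅ ∨ s = univ) :
    (Measure.dirac (1 : G)).IsHaarMeasure where
  lt_top_of_isCompact := fun K _ => measure_lt_top _ K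
  map_mul_left_eq_self := fun g => by
    rw [Measure.map_dirac' (measurable_of_trivial hG _)]
    refine Measure.ext fun s hs => ?_
    rcases hG s hs with rfl | rfl
    · simp
    · rw [measure_univ, measure_univ]
  open_pos := fun U _ hU => by
    rw [measure_eq_measure_univ_of_trivial hG _ hU, measure_univ]
    exact one_ne_zero

/-- **On the trivial σ-algebra of a topological additive group, the Dirac mass `δ₀` is an additive
Haar measure in Mathlib's sense** (finite; positive on non-empty opens, which have outer measure
`1`; translation invariant as a measure on `{∅, univ}`). [folklore] -/
theorem isAddHaarMeasure_dirac_of_trivial {G : Type*} [AddGroup G] [TopologicalSpace G]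
    [MeasurableSpace G] (hG : ∀ s : Set G, MeasurableSet s → s = ∅ ∨ s = univ) :
    (Measure.dirac (0 : G)).IsAddHaarMeasure where
  lt_top_of_isCompact := fun K _ => measure_lt_top _ K
  map_add_left_eq_self := fun g => by
    rw [Measure.map_dirac' (measurable_of_trivial hG _)]
    refine Measure.ext fun s hs => ?_
    rcases hG s hs with rfl | rfl
    · simp
    · rw [measure_univ, measure_univ]
  open_pos := fun U _ hU => by
    rw [measure_eq_measure_univ_of_trivial hG _ hU, measure_univ]
    exact one_ne_zero

end TrivialSigma

/-! ### A non-archimedean local field is not compact; Schwartz–Bruhat functions have zeros -/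

section LocalField

variable {F : Type*} [Field F] [ValuativeRel F] [TopologicalSpace F] [IsNonarchimedeanLocalField F]

/-- **A non-archimedean local field is not compact**: the open balls `{v < t^k}`, `t > 1`
(`t = γ⁻¹` for a value `0 < γ < 1`, `ValuativeRel.IsNontrivial`), cover `F` (the value group is
archimedean, `MulArchimedean` from `ValuativeRel.IsRankLeOne`) and increase with `k`, but no single
one is `F` (the valuation is surjective onto the value group). (Weil 1967, Ch. I §2.) [folklore] -/
theorem not_compactSpace_of_isNonarchimedeanLocalField : ¬ CompactSpace F := by
  intro hF
  obtain ⟨γ, hγ0, hγ1⟩ := ValuativeRel.IsNontrivial.exists_lt_one (R := F)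
  have ht : 1 < γ⁻¹ := (one_lt_inv₀ hγ0).2 hγ1
  have ht0 : γ⁻¹ ≠ 0 := inv_ne_zero hγ0.ne'
  set U : ℕ → Set F := fun k => {x | valuation F x < γ⁻¹ ^ k} with hU
  have hUo : ∀ k, IsOpen (U k) := fun k => by
    rw [isOpen_iff_mem_nhds]
    intro x hx
    rw [IsValuativeTopology.mem_nhds_iff']
    refine ⟨Units.mk0 (γ⁻¹ ^ k) (pow_ne_zero _ ht0), fun z hz => ?_⟩
    have hz' : valuation F (z - x) < γ⁻¹ ^ k := by simpa using hz
    have hx' : valuation F x < γ⁻¹ ^ k := hx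
    show valuation F z < γ⁻¹ ^ k
    calc valuation F z = valuation F (z - x + x) := by rw [sub_add_cancel]
      _ ≤ max (valuation F (z - x)) (valuation F x) := Valuation.map_add _ _ _
      _ < γ⁻¹ ^ k := max_lt hz' hx'
  have hcov : (univ : Set F) ⊆ ⋃ k, U k := fun x _ => by
    obtain ⟨k, hk⟩ := MulArchimedean.arch (valuation F x) ht
    exact mem_iUnion.2 ⟨k + 1, lt_of_le_of_lt hk (pow_lt_pow_right₀ ht (Nat.lt_succ_self k))⟩
  obtain ⟨T, hT⟩ := (@isCompact_univ F _ hF).elim_finite_subcover U hUo hcov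
  have hmono : ∀ {k l : ℕ}, k ≤ l → U k ⊆ U l := fun hkl x hx =>
    lt_of_lt_of_le hx (pow_le_pow_right₀ ht.le hkl)
  obtain ⟨g, hg⟩ := ValuativeRel.valuation_surjective (γ⁻¹ ^ (T.sup id) : ValueGroupWithZero F)
  have hmem := hT (mem_univ g)
  simp only [mem_iUnion] at hmem
  obtain ⟨k, hk, hgk⟩ := hmem
  have hlt : valuation F g < γ⁻¹ ^ (T.sup id) := hmono (Finset.le_sup (f := id) hk) hgk
  rw [hg] at hlt
  exact lt_irrefl _ hlt

/-- A Schwartz–Bruhat function on a non-archimedean local field vanishes at some non-zero point: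
otherwise its (compact) topological support together with `{0}` would be all of `F`, which is
not compact. [folklore] -/
theorem exists_ne_zero_and_eq_zero_of_mem_schwartzBruhat {f : F → ℂ} (hf : f ∈ SchwartzBruhat F) :
    ∃ x : F, x ≠ 0 ∧ f x = 0 := by
  by_contra h
  push Not at h
  refine not_compactSpace_of_isNonarchimedeanLocalField (F := F) ⟨?_⟩
  have hK : IsCompact (tsupport f ∪ {0}) := hf.2.isCompact.union isCompact_singleton
  refine hK.of_isClosed_subset isClosed_univ fun x _ => ?_
  by_cases hx : x = 0
  · exact Or.inr hx
  · exact Or.inl (subset_tsupport f (Function.mem_support.2 (h x hx)))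

end LocalField

/-! ### Tate's integrals against measures on the trivial σ-algebra -/

section TateTrivial

variable {F : Type*} [Field F] [ValuativeRel F] [TopologicalSpace F] [IsNonarchimedeanLocalField F]
  [MeasurableSpace F]

/-- **On the trivial σ-algebra every Fourier transform of a Schwartz–Bruhat function vanishes**:
the integrand `x ↦ ψ(xy) f(x)` is `0` (if `f = 0`) or non-constant (`f` has a zero and a non-zero
value, `|ψ| = 1`), so its Bochner integral is `0` (`integral_eq_zero_of_trivial`). [folklore] -/
theorem fourierSB_eq_zero_of_trivial (hF : ∀ s : Set F, MeasurableSet s → s = ∅ ∨ s = univ)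
    (ψ : AddChar F Circle) (μ : Measure F) {f : F → ℂ} (hf : f ∈ SchwartzBruhat F) :
    fourierSB ψ μ f = 0 := by
  funext y
  rw [fourierSB_apply, Pi.zero_apply]
  obtain ⟨x₁, -, hx₁⟩ := exists_ne_zero_and_eq_zero_of_mem_schwartzBruhat hf
  by_cases h0 : ∀ x, f x = 0
  · simp [h0]
  push Not at h0
  obtain ⟨x₀, hx₀⟩ := h0
  refine integral_eq_zero_of_trivial hF μ (x := x₀) (y := x₁) ?_
  rw [hx₁, mul_zero]
  exact mul_ne_zero (Circle.coe_ne_zero _) hx₀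

/-- **On the trivial σ-algebra every Tate zeta integral of a Schwartz–Bruhat function vanishes**
(for every measure `μ'` on `Fˣ`, whose σ-algebra is again trivial, `trivial_units`): the integrand
`x ↦ f(x) χ(x) |x|^s` on `Fˣ` is `0` or non-constant (`f` vanishes at some unit and `χ(x) |x|^s ≠ 0`).
[folklore] -/
theorem tateZeta_eq_zero_of_trivial (hF : ∀ s : Set F, MeasurableSet s → s = ∅ ∨ s = univ)
    (μ' : Measure Fˣ) {f : F → ℂ} (hf : f ∈ SchwartzBruhat F) (χ : QuasiChar F) (s : ℂ) :
    tateZeta μ' f χ s = 0 := by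
  unfold tateZeta
  obtain ⟨x₁, hx₁0, hx₁⟩ := exists_ne_zero_and_eq_zero_of_mem_schwartzBruhat hf
  by_cases h0 : ∀ x : Fˣ, f x = 0
  · simp [h0]
  push Not at h0
  obtain ⟨x₀, hx₀⟩ := h0
  refine integral_eq_zero_of_trivial (trivial_units hF) μ' (x := x₀) (y := Units.mk0 x₁ hx₁0) ?_
  rw [Units.val_mk0, hx₁, zero_mul, zero_mul]
  exact mul_ne_zero (mul_ne_zero hx₀ (Units.ne_zero _)) (normAbs_cpow_ne_zero _ _)

/-- **On the trivial σ-algebra EVERY `γ ∈ ℂ(T)` satisfies Tate's functional equation**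
`HasTateGamma ψ μ μ' χ γ`, for all `ψ, μ, μ', χ`: both zeta integrals in
`Z(f̂, χ⁻¹, 1 - s) = γ(q^{-s}) Z(f, χ, s)` vanish (`fourierSB_eq_zero_of_trivial`,
`tateZeta_eq_zero_of_trivial`). [folklore] -/
theorem hasTateGamma_of_trivial (hF : ∀ s : Set F, MeasurableSet s → s = ∅ ∨ s = univ)
    (ψ : AddChar F Circle) (μ : Measure F) (μ' : Measure Fˣ) (χ : QuasiChar F) (γ : RatFunc ℂ) :
    HasTateGamma ψ μ μ' χ γ := by
  intro σ _ f hf s _ _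
  rw [fourierSB_eq_zero_of_trivial hF ψ μ hf, tateZeta_eq_zero_of_trivial hF μ' hf, mul_zero]
  simp [tateZeta]

/-- Consequently every pair `(e, a)` is "`ε`-data" on the trivial σ-algebra. [folklore] -/
theorem hasTateEpsilon_of_trivial (hF : ∀ s : Set F, MeasurableSet s → s = ∅ ∨ s = univ)
    (ψ : AddChar F Circle) (μ : Measure F) (μ' : Measure Fˣ) (χ : QuasiChar F) (e : ℂ) (a : ℤ) :
    HasTateEpsilon ψ μ μ' χ e a :=
  hasTateGamma_of_trivial hF ψ μ μ' χ _

/-- **`existsUnique_hasTateGamma` fails on the trivial σ-algebra** for every continuous non-trivial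
`ψ`, every additive Haar `μ` (e.g. `δ₀`, `isAddHaarMeasure_dirac_of_trivial`), every Haar `μ'` on
`Fˣ` (e.g. `δ₁`) and every `χ`: `γ = 0` and `γ = 1` both satisfy the functional equation. [folklore] -/
theorem not_existsUnique_hasTateGamma_of_trivial
    (hF : ∀ s : Set F, MeasurableSet s → s = ∅ ∨ s = univ) {ψ : AddChar F Circle}
    (hψ : ψ.IsContinuousNontrivial) (μ : Measure F) [μ.IsAddHaarMeasure] (μ' : Measure Fˣ)
    [μ'.IsHaarMeasure] (χ : QuasiChar F) : ¬ existsUnique_hasTateGamma ψ μ μ' χ := by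
  intro h
  obtain ⟨γ, -, huniq⟩ := h hψ
  have h0 := huniq 0 (hasTateGamma_of_trivial hF ψ μ μ' χ 0)
  have h1 := huniq 1 (hasTateGamma_of_trivial hF ψ μ μ' χ 1)
  exact zero_ne_one (h0.trans h1.symm)

/-- **`existsUnique_hasTateEpsilon` fails on the trivial σ-algebra**: `(0, 0)` and `(1, 0)` are both
`ε`-data. [folklore] -/
theorem not_existsUnique_hasTateEpsilon_of_trivial
    (hF : ∀ s : Set F, MeasurableSet s → s = ∅ ∨ s = univ) {ψ : AddChar F Circle}
    (hψ : ψ.IsContinuousNontrivial) (μ : Measure F) [μ.IsAddHaarMeasure] (μ' : Measure Fˣ)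
    [μ'.IsHaarMeasure] (χ : QuasiChar F) : ¬ existsUnique_hasTateEpsilon ψ μ μ' χ := by
  intro h
  obtain ⟨ea, -, huniq⟩ := h hψ
  have h0 := huniq (0, 0) (hasTateEpsilon_of_trivial hF ψ μ μ' χ 0 0)
  have h1 := huniq (1, 0) (hasTateEpsilon_of_trivial hF ψ μ μ' χ 1 0)
  have h01 := congrArg Prod.fst (h0.trans h1.symm)
  exact zero_ne_one h01

/-- **`hasTateEpsilon_ne_zero` fails on the trivial σ-algebra**: `(e, a) = (0, 0)` is an `ε`-datum
with `e = 0`. [folklore] -/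
theorem not_hasTateEpsilon_ne_zero_of_trivial
    (hF : ∀ s : Set F, MeasurableSet s → s = ∅ ∨ s = univ) {ψ : AddChar F Circle}
    (hψ : ψ.IsContinuousNontrivial) (μ : Measure F) [μ.IsAddHaarMeasure] (μ' : Measure Fˣ)
    [μ'.IsHaarMeasure] (χ : QuasiChar F) :
    ¬ hasTateEpsilon_ne_zero (ψ := ψ) (μ := μ) (μ' := μ') (χ := χ) :=
  fun h => h hψ (hasTateEpsilon_of_trivial hF ψ μ μ' χ 0 0) rfl

omit [MeasurableSpace F] in
/-- The trivial quasi-character has conductor exponent `0` (it is trivial on `U⁰ = 𝒪ˣ`, and there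
is no `b < 0`). [folklore] -/
theorem QuasiChar.hasConductorExp_one_zero : (1 : QuasiChar F).HasConductorExp 0 :=
  ⟨fun _ _ => rfl, fun b hb => absurd hb (Nat.not_lt_zero b)⟩

/-- **`hasTateEpsilon_exponent` fails on the trivial σ-algebra** (for `χ = 1`): `ψ` has a conductor
exponent `m` (`AddChar.IsContinuousNontrivial.exists_hasConductorExp`), `χ = 1` has conductor
exponent `0`, and both `(0, -m)` and `(0, 1 - m)` are `ε`-data, so `a = 0 - m` cannot hold for all
of them. [folklore] -/
theorem not_hasTateEpsilon_exponent_of_trivial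
    (hF : ∀ s : Set F, MeasurableSet s → s = ∅ ∨ s = univ) {ψ : AddChar F Circle}
    (hψ : ψ.IsContinuousNontrivial) (μ : Measure F) [μ.IsAddHaarMeasure] (μ' : Measure Fˣ)
    [μ'.IsHaarMeasure] :
    ¬ hasTateEpsilon_exponent (ψ := ψ) (μ := μ) (μ' := μ') (χ := (1 : QuasiChar F)) := by
  intro h
  obtain ⟨m, hm⟩ := hψ.exists_hasConductorExp
  have h1 := h hψ (hasTateEpsilon_of_trivial hF ψ μ μ' 1 0 (1 - m)) hm
    QuasiChar.hasConductorExp_one_zero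
  push_cast at h1
  omega

end TateTrivial

/-! ### Closed counterexamples -/

section Counterexample

/-- **The named fact `existsUnique_hasTateGamma` of `TateLocalFactors`, universally closed, is
FALSE.** Counterexample: `F = ℚ_v` for a finite place `v` of `ℚ` at which the local component `ψ_v`
of Tate's character is non-trivial (`eventually_exists_adeleAddCharAt_ne_one`; continuous by
`continuous_adeleAddCharAt`), with its TRIVIAL σ-algebra `⊥` — admitted by the fact because its
`[BorelSpace F]` hypothesis was a section instance not captured by the `def` — `μ = δ₀` (an additive
Haar measure on `⊥`), `μ' = δ₁` (a Haar measure on `Fˣ`), `χ = 1`: every `γ` satisfies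
`HasTateGamma` (`hasTateGamma_of_trivial`), contradicting `∃!`. The intended statement (Tate 1950,
Thm. 2.4.1) binds `[BorelSpace F]`. [folklore] -/
theorem not_forall_existsUnique_hasTateGamma :
    ¬ ∀ (F : Type) [Field F] [ValuativeRel F] [TopologicalSpace F] [IsNonarchimedeanLocalField F]
        [MeasurableSpace F] (ψ : AddChar F Circle) (μ : Measure F) (μ' : Measure Fˣ)
        (χ : QuasiChar F), existsUnique_hasTateGamma ψ μ μ' χ := by
  intro h
  haveI := infinite_heightOneSpectrum' ℚ
  obtain ⟨v, u, -, hu⟩ := (eventually_exists_adeleAddCharAt_ne_one ℚ).exists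
  letI : MeasurableSpace (v.adicCompletion ℚ) := ⊥
  have hbot : ∀ s : Set (v.adicCompletion ℚ), MeasurableSet s → s = ∅ ∨ s = univ :=
    fun s hs => MeasurableSpace.measurableSet_bot_iff.1 hs
  have hψ : (adeleAddCharAt ℚ v).IsContinuousNontrivial :=
    ⟨continuous_adeleAddCharAt ℚ v, fun h0 => hu (by rw [h0, AddChar.zero_apply])⟩
  haveI := isAddHaarMeasure_dirac_of_trivial hbot
  haveI := isHaarMeasure_dirac_of_trivial (trivial_units hbot)
  exact not_existsUnique_hasTateGamma_of_trivial hbot hψ (Measure.dirac 0) (Measure.dirac 1) 1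
    (h (v.adicCompletion ℚ) (adeleAddCharAt ℚ v) _ _ 1)

/-- **The named fact `existsUnique_hasTateEpsilon` of `TateLocalFactors`, universally closed, is
FALSE** (same counterexample: on the trivial σ-algebra of `ℚ_v` every `(e, a)` is an `ε`-datum).
[folklore] -/
theorem not_forall_existsUnique_hasTateEpsilon :
    ¬ ∀ (F : Type) [Field F] [ValuativeRel F] [TopologicalSpace F] [IsNonarchimedeanLocalField F]
        [MeasurableSpace F] (ψ : AddChar F Circle) (μ : Measure F) (μ' : Measure Fˣ)
        (χ : QuasiChar F), existsUnique_hasTateEpsilon ψ μ μ' χ := by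
  intro h
  haveI := infinite_heightOneSpectrum' ℚ
  obtain ⟨v, u, -, hu⟩ := (eventually_exists_adeleAddCharAt_ne_one ℚ).exists
  letI : MeasurableSpace (v.adicCompletion ℚ) := ⊥
  have hbot : ∀ s : Set (v.adicCompletion ℚ), MeasurableSet s → s = ∅ ∨ s = univ :=
    fun s hs => MeasurableSpace.measurableSet_bot_iff.1 hs
  have hψ : (adeleAddCharAt ℚ v).IsContinuousNontrivial :=
    ⟨continuous_adeleAddCharAt ℚ v, fun h0 => hu (by rw [h0, AddChar.zero_apply])⟩
  haveI := isAddHaarMeasure_dirac_of_trivial hbot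
  haveI := isHaarMeasure_dirac_of_trivial (trivial_units hbot)
  exact not_existsUnique_hasTateEpsilon_of_trivial hbot hψ (Measure.dirac 0) (Measure.dirac 1) 1
    (h (v.adicCompletion ℚ) (adeleAddCharAt ℚ v) _ _ 1)

/-- **The named fact `hasTateEpsilon_ne_zero` of `TateLocalFactors`, universally closed, is FALSE**
(on the trivial σ-algebra of `ℚ_v`, `(0, 0)` is an `ε`-datum). [folklore] -/
theorem not_forall_hasTateEpsilon_ne_zero :
    ¬ ∀ (F : Type) [Field F] [ValuativeRel F] [TopologicalSpace F] [IsNonarchimedeanLocalField F]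
        [MeasurableSpace F] (ψ : AddChar F Circle) (μ : Measure F) (μ' : Measure Fˣ)
        (χ : QuasiChar F), hasTateEpsilon_ne_zero (ψ := ψ) (μ := μ) (μ' := μ') (χ := χ) := by
  intro h
  haveI := infinite_heightOneSpectrum' ℚ
  obtain ⟨v, u, -, hu⟩ := (eventually_exists_adeleAddCharAt_ne_one ℚ).exists
  letI : MeasurableSpace (v.adicCompletion ℚ) := ⊥
  have hbot : ∀ s : Set (v.adicCompletion ℚ), MeasurableSet s → s = ∅ ∨ s = univ :=
    fun s hs => MeasurableSpace.measurableSet_bot_iff.1 hs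
  have hψ : (adeleAddCharAt ℚ v).IsContinuousNontrivial :=
    ⟨continuous_adeleAddCharAt ℚ v, fun h0 => hu (by rw [h0, AddChar.zero_apply])⟩
  haveI := isAddHaarMeasure_dirac_of_trivial hbot
  haveI := isHaarMeasure_dirac_of_trivial (trivial_units hbot)
  exact not_hasTateEpsilon_ne_zero_of_trivial hbot hψ (Measure.dirac 0) (Measure.dirac 1) 1
    (h (v.adicCompletion ℚ) (adeleAddCharAt ℚ v) _ _ 1)

/-- **The named fact `hasTateEpsilon_exponent` of `TateLocalFactors`, universally closed, is FALSE**
(on the trivial σ-algebra of `ℚ_v` with `χ = 1`, the exponent `a` of an `ε`-datum is arbitrary).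
[folklore] -/
theorem not_forall_hasTateEpsilon_exponent :
    ¬ ∀ (F : Type) [Field F] [ValuativeRel F] [TopologicalSpace F] [IsNonarchimedeanLocalField F]
        [MeasurableSpace F] (ψ : AddChar F Circle) (μ : Measure F) (μ' : Measure Fˣ)
        (χ : QuasiChar F), hasTateEpsilon_exponent (ψ := ψ) (μ := μ) (μ' := μ') (χ := χ) := by
  intro h
  haveI := infinite_heightOneSpectrum' ℚ
  obtain ⟨v, u, -, hu⟩ := (eventually_exists_adeleAddCharAt_ne_one ℚ).exists
  letI : MeasurableSpace (v.adicCompletion ℚ) := ⊥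
  have hbot : ∀ s : Set (v.adicCompletion ℚ), MeasurableSet s → s = ∅ ∨ s = univ :=
    fun s hs => MeasurableSpace.measurableSet_bot_iff.1 hs
  have hψ : (adeleAddCharAt ℚ v).IsContinuousNontrivial :=
    ⟨continuous_adeleAddCharAt ℚ v, fun h0 => hu (by rw [h0, AddChar.zero_apply])⟩
  haveI := isAddHaarMeasure_dirac_of_trivial hbot
  haveI := isHaarMeasure_dirac_of_trivial (trivial_units hbot)
  exact not_hasTateEpsilon_exponent_of_trivial hbot hψ (Measure.dirac 0) (Measure.dirac 1)
    (h (v.adicCompletion ℚ) (adeleAddCharAt ℚ v) _ _ 1)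

end Counterexample

end Literature.NumberTheory.Automorphic
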